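import Literature.NumberTheory.EllipticCurves.UnramifiedLayerRootsProofs
import Literature.NumberTheory.EllipticCurves.LocalFrobeniusGenerationProofs
import Mathlib.FieldTheory.KrullTopology
import Mathlib.Data.Fintype.Pigeonhole
import HarnessLib

/-!
# Inertia-invariant elements and points lie in a finite unramified layer `K_v(ζ_{qⁿ-1})`

`Proofs` file (theorems only, no definitions, no named facts) in topic
`NumberTheory/EllipticCurves`; a bottom-up step of the discharge of the named fact
`Literature.NumberTheory.EllipticCurves.Milne2006_unramifiedClass_eq_zero` (`PeriodIndexSupport`;
Milne, *Arithmetic Duality Theorems*, Prop. I.3.8).  In Milne's notation the module is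
`A(K^un) = ∪_n A(K_n)`, the union over the finite unramified layers; in the tree the maximal
unramified extension of `K_v` inside `K̄_v` is the fixed field of the inertia group `I_𝔐`, and the
layers are `K_v(ζ)`, `ζ` a primitive `(qⁿ - 1)`-th root of unity (`UnramifiedLayerRootsProofs`).
This file proves that **every element (resp. point) fixed by `I_𝔐` lies in some layer**, in the
form needed by the discharge, where the Lang–Hensel lift of the tree
(`WeierstrassCurve.exists_lift_sub_mem_kernel`, `GoodReductionLangLift`) is only known to be
`I_𝔐`-invariant:

* `exists_frobenius_pow_smul_eq_self`: for every `x ∈ K̄_v` some power `Fᵈ`, `d ≥ 1`, of the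
  Frobenius fixes `x` (the `F`-orbit of `x` lies in the finite set of roots of its minimal
  polynomial);
* `mem_adjoin_of_inertia_of_frobenius_pow_smul_eq` (**descent to the layer**): if `I_𝔐` fixes
  `x` and `Fᵈ x = x` then `x ∈ K_v(ζ)` for any primitive `(qᵈ - 1)`-th root of unity `ζ` — every
  `σ` fixing `ζ` is `Fⁱ τ u` with `d ∣ i`, `τ ∈ I_𝔐`, `u` in the open stabiliser of `x` and `ζ`
  (`exists_eq_frobenius_pow_mul_inertia_mul`, `LocalFrobeniusGenerationProofs`), hence fixes `x`;
  conclude by Galois descent (`mem_adjoin_of_forall_smul_eq`);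
* `adjoin_le_adjoin_of_dvd`: the layers increase, `K_v(ζ_{qᵈ-1}) ⊆ K_v(ζ_{qⁿ-1})` for `d ∣ n`,
  and so do the groups of points with coordinates in them (`range_map_val_mono`);
* `exists_mem_range_map_val_of_inertia` (**points**): an `I_𝔐`-invariant point of a Weierstrass
  equation over `K_v` has coordinates in `K_v(ζ_{qᵈ-1})` for some `d ≥ 1`.

## References

* [MilneADT2006] J. S. Milne, *Arithmetic Duality Theorems*, 2nd ed. (2006), §I.2 (`K^un`),
  Prop. I.3.8.
* [SerreLocalFields1979] J.-P. Serre, *Local Fields* (1979), Ch. IV §4 (`K_nr = ∪ K(μ_m)`).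
* [NeukirchANT1999] J. Neukirch, *Algebraic Number Theory* (1999), Ch. II §9 (9.9)–(9.11).

## Design

No definitions; `noncomputable section`; `open scoped Classical NNReal Pointwise`; one universe `u`.
-/

noncomputable section

open scoped Classical NNReal Pointwise
open NumberField IsDedekindDomain Polynomial

universe u

namespace IsDedekindDomain.HeightOneSpectrum

open Literature.NumberTheory.EllipticCurves Literature.NumberTheory.GaloisRepresentations Field

variable {K : Type u} [Field K] [NumberField K] {v : HeightOneSpectrum (𝓞 K)}
  {w : Valuation (AlgebraicClosure (v.adicCompletion K)) ℝ≥0}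
  (hw : ∀ x, (w x : ℝ) = spectralNorm (v.adicCompletion K) (AlgebraicClosure (v.adicCompletion K)) x)

/-- **Every element of `K̄_v` is fixed by some power `Fᵈ`, `d ≥ 1`, of a given automorphism**
(its orbit lies among the finitely many roots of its minimal polynomial over `K_v`). [folklore] -/
theorem exists_frobenius_pow_smul_eq_self (F : absoluteGaloisGroup (v.adicCompletion K))
    (x : AlgebraicClosure (v.adicCompletion K)) : ∃ d : ℕ, d ≠ 0 ∧ F ^ d • x = x := by
  have hint : IsIntegral (v.adicCompletion K) x := Algebra.IsIntegral.isIntegral x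
  have hp0 : minpoly (v.adicCompletion K) x ≠ 0 := minpoly.ne_zero hint
  -- the `F`-orbit of `x` lies in the root set of the minimal polynomial
  have hmem : ∀ i : ℕ, F ^ i • x ∈
      (minpoly (v.adicCompletion K) x).rootSet (AlgebraicClosure (v.adicCompletion K)) := by
    intro i
    rw [Polynomial.mem_rootSet_of_ne hp0, absoluteGaloisGroup.smul_def, Polynomial.aeval_algHom_apply,
      minpoly.aeval, map_zero]
  haveI : Finite ((minpoly (v.adicCompletion K) x).rootSet (AlgebraicClosure (v.adicCompletion K))) :=
    (Polynomial.rootSet_finite _ _).to_subtype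
  obtain ⟨i, j, hij, he⟩ := Finite.exists_ne_map_eq_of_infinite
    (fun i : ℕ ↦ (⟨F ^ i • x, hmem i⟩ :
      (minpoly (v.adicCompletion K) x).rootSet (AlgebraicClosure (v.adicCompletion K))))
  have he' : F ^ i • x = F ^ j • x := congrArg Subtype.val he
  -- `Fⁱ x = Fʲ x` with `i ≠ j` gives `F^{|i-j|} x = x`
  rcases lt_or_gt_of_ne hij with h | h
  · refine ⟨j - i, Nat.sub_ne_zero_of_lt h, ?_⟩
    have e : F ^ j = F ^ i * F ^ (j - i) := by rw [← pow_add, Nat.add_sub_cancel' h.le]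
    rw [e, mul_smul] at he'
    exact (smul_left_cancel_iff (F ^ i)).mp he'.symm
  · refine ⟨i - j, Nat.sub_ne_zero_of_lt h, ?_⟩
    have e : F ^ i = F ^ j * F ^ (i - j) := by rw [← pow_add, Nat.add_sub_cancel' h.le]
    rw [e, mul_smul] at he'
    exact (smul_left_cancel_iff (F ^ j)).mp he'

/-- The stabiliser of an element of `K̄_v` in `Γ_{K_v}` is open (it contains `Gal(K̄_v/K_v(x))`).
[folklore] -/
theorem isOpen_stabilizer_algebraicClosure (x : AlgebraicClosure (v.adicCompletion K)) :
    IsOpen ((MulAction.stabilizer (absoluteGaloisGroup (v.adicCompletion K)) x :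
      Subgroup (absoluteGaloisGroup (v.adicCompletion K))) : Set (absoluteGaloisGroup (v.adicCompletion K))) := by
  haveI : FiniteDimensional (v.adicCompletion K) (IntermediateField.adjoin (v.adicCompletion K) {x}) :=
    IntermediateField.adjoin.finiteDimensional (Algebra.IsIntegral.isIntegral x)
  have hopen := (IntermediateField.adjoin (v.adicCompletion K) {x}).fixingSubgroup_isOpen
  refine Subgroup.isOpen_mono (H₁ := ((IntermediateField.adjoin (v.adicCompletion K) {x}).fixingSubgroup :
    Subgroup (absoluteGaloisGroup (v.adicCompletion K)))) (fun σ hσ ↦ ?_) hopen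
  change σ • x = x
  exact (IntermediateField.mem_fixingSubgroup_iff _ _).mp hσ x
    (IntermediateField.mem_adjoin_simple_self (v.adicCompletion K) x)

include hw in
/-- **Descent to the layer.**  If `x ∈ K̄_v` is fixed by the inertia group `I_𝔐` and by `Fᵈ` for an
arithmetic Frobenius `F` and `d ≥ 1`, then `x ∈ K_v(ζ)` for every primitive `(qᵈ - 1)`-th root of
unity `ζ` (every `σ` fixing `ζ` factors as `Fⁱ τ u`, `d ∣ i`, `τ ∈ I_𝔐`, `u` fixing `x` and `ζ`;
Milne, *ADT*, §I.2: `A(K^un) = ∪ A(K_n)`; Serre, *Local Fields*, IV §4).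
[cite: SerreLocalFields1979, Ch. IV §4 Prop. 16] -/
theorem mem_adjoin_of_inertia_of_frobenius_pow_smul_eq {𝔐 : Ideal v.localAbsIntegers}
    (h𝔐 : 𝔐 ∈ v.localPrimesAbove) {F : absoluteGaloisGroup (v.adicCompletion K)}
    (hF : IsArithFrobAt (v.adicCompletionIntegers K) F 𝔐) {d : ℕ} (hd : d ≠ 0)
    {ζ : AlgebraicClosure (v.adicCompletion K)}
    (hζ : IsPrimitiveRoot ζ (Nat.card (IsLocalRing.ResidueField (v.adicCompletionIntegers K)) ^ d - 1))
    {x : AlgebraicClosure (v.adicCompletion K)}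
    (hI : ∀ τ ∈ 𝔐.inertia (absoluteGaloisGroup (v.adicCompletion K)), τ • x = x)
    (hFd : F ^ d • x = x) :
    x ∈ IntermediateField.adjoin (v.adicCompletion K) {ζ} := by
  have hm0 := residueCard_pow_sub_one_ne_zero (v := v) hd
  have hmw : w ((Nat.card (IsLocalRing.ResidueField (v.adicCompletionIntegers K)) ^ d - 1 : ℕ) :
      AlgebraicClosure (v.adicCompletion K)) = 1 :=
    spectralValuation_natCast_residueCard_pow_sub_one hw hd
  have hFdk : ∀ k : ℕ, F ^ (d * k) • x = x := by
    intro k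
    induction k with
    | zero => rw [mul_zero, pow_zero, one_smul]
    | succ k ih => rw [Nat.mul_succ, pow_add, mul_smul, hFd, ih]
  refine mem_adjoin_of_forall_smul_eq (v := v) fun σ hσ ↦ ?_
  -- the open stabiliser of `x` and `ζ`
  let U : Subgroup (absoluteGaloisGroup (v.adicCompletion K)) :=
    MulAction.stabilizer (absoluteGaloisGroup (v.adicCompletion K)) x ⊓
      MulAction.stabilizer (absoluteGaloisGroup (v.adicCompletion K)) ζ
  have hU : IsOpen (U : Set (absoluteGaloisGroup (v.adicCompletion K))) :=
    (isOpen_stabilizer_algebraicClosure x).inter (isOpen_stabilizer_algebraicClosure ζ)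
  obtain ⟨i, τ, u, hτ, hu, rfl⟩ := exists_eq_frobenius_pow_mul_inertia_mul v h𝔐 hF hU σ
  have hux : u • x = x := hu.1
  have huζ : u • ζ = ζ := hu.2
  have hτζ : τ • ζ = ζ := smul_eq_self_of_mem_inertia_of_pow_eq_one hw h𝔐 hτ hm0 hmw hζ.pow_eq_one
  -- `σ ζ = ζ` forces `d ∣ i`
  have hi : F ^ i • ζ = ζ := by
    have := hσ
    rwa [mul_smul, mul_smul, huζ, hτζ] at this
  obtain ⟨k, rfl⟩ := (frobenius_pow_smul_eq_self_iff hw h𝔐 hF hd hζ i).mp hi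
  rw [mul_smul, mul_smul, hux, hI τ hτ, hFdk]

/-- **The layers increase**: `K_v(ζ_{qᵈ-1}) ⊆ K_v(ζ_{qⁿ-1})` for `d ∣ n` (`ζ_{qᵈ-1}` is a power
of `ζ_{qⁿ-1}` as `qᵈ - 1 ∣ qⁿ - 1`). [folklore] -/
theorem adjoin_le_adjoin_of_dvd {d n : ℕ} (hdn : d ∣ n) (hn : n ≠ 0)
    {ζd ζn : AlgebraicClosure (v.adicCompletion K)}
    (hζd : IsPrimitiveRoot ζd (Nat.card (IsLocalRing.ResidueField (v.adicCompletionIntegers K)) ^ d - 1))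
    (hζn : IsPrimitiveRoot ζn (Nat.card (IsLocalRing.ResidueField (v.adicCompletionIntegers K)) ^ n - 1)) :
    IntermediateField.adjoin (v.adicCompletion K) {ζd} ≤
      IntermediateField.adjoin (v.adicCompletion K) {ζn} := by
  set q := Nat.card (IsLocalRing.ResidueField (v.adicCompletionIntegers K)) with hq
  obtain ⟨k, rfl⟩ := hdn
  have hdvd : q ^ d - 1 ∣ q ^ (d * k) - 1 := by
    have := Nat.sub_dvd_pow_sub_pow (q ^ d) 1 k
    rwa [one_pow, ← pow_mul] at this
  have hpow : ζd ^ (q ^ (d * k) - 1) = 1 := by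
    obtain ⟨c, hc⟩ := hdvd
    rw [hc, pow_mul, hζd.pow_eq_one, one_pow]
  haveI : NeZero (q ^ (d * k) - 1) := ⟨residueCard_pow_sub_one_ne_zero (v := v) hn⟩
  obtain ⟨i, -, hi⟩ := hζn.eq_pow_of_pow_eq_one hpow
  rw [IntermediateField.adjoin_simple_le_iff, ← hi]
  exact pow_mem (IntermediateField.mem_adjoin_simple_self _ ζn) i

/-- Points with coordinates in a smaller intermediate field have coordinates in a bigger one:
the range of `Point.map (val K₁)` is contained in that of `Point.map (val K₂)` for `K₁ ≤ K₂`.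
[folklore] -/
theorem range_map_val_mono (X : WeierstrassCurve (v.adicCompletion K))
    {K₁ K₂ : IntermediateField (v.adicCompletion K) (AlgebraicClosure (v.adicCompletion K))}
    (h : K₁ ≤ K₂) :
    (WeierstrassCurve.Affine.Point.map (W' := X) (IntermediateField.val K₁)).range ≤
      (WeierstrassCurve.Affine.Point.map (W' := X) (IntermediateField.val K₂)).range := by
  rintro P ⟨P₀, rfl⟩
  refine ⟨WeierstrassCurve.Affine.Point.map (IntermediateField.inclusion h) P₀, ?_⟩
  rw [WeierstrassCurve.Affine.Point.map_map]
  rfl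

include hw in
/-- **An `I_𝔐`-invariant point lies in a finite unramified layer**: for a Weierstrass equation `X`
over `K_v` and a point `b` of `X` over `K̄_v` fixed by the inertia group, there is `d ≥ 1` such
that `b` has coordinates in `K_v(ζ)` for every primitive `(qᵈ - 1)`-th root of unity `ζ`
(`A(K^un) = ∪ A(K_n)`, Milne, *ADT*, §I.2). [cite: MilneADT2006, Ch. I §2 (notation K^un) and Prop. 3.8] -/
theorem exists_mem_range_map_val_of_inertia {𝔐 : Ideal v.localAbsIntegers}
    (h𝔐 : 𝔐 ∈ v.localPrimesAbove) {F : absoluteGaloisGroup (v.adicCompletion K)}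
    (hF : IsArithFrobAt (v.adicCompletionIntegers K) F 𝔐) (X : WeierstrassCurve (v.adicCompletion K))
    {b : (X.baseChange (AlgebraicClosure (v.adicCompletion K))).toAffine.Point}
    (hb : ∀ τ ∈ 𝔐.inertia (absoluteGaloisGroup (v.adicCompletion K)),
      WeierstrassCurve.Affine.Point.map ((absoluteGaloisGroup.toAlgEquiv (v.adicCompletion K) τ :
        AlgebraicClosure (v.adicCompletion K) ≃ₐ[v.adicCompletion K] AlgebraicClosure (v.adicCompletion K)) :
        AlgebraicClosure (v.adicCompletion K) →ₐ[v.adicCompletion K] AlgebraicClosure (v.adicCompletion K)) b = b) :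
    ∃ d : ℕ, d ≠ 0 ∧ ∀ {ζ : AlgebraicClosure (v.adicCompletion K)},
      IsPrimitiveRoot ζ (Nat.card (IsLocalRing.ResidueField (v.adicCompletionIntegers K)) ^ d - 1) →
      b ∈ (WeierstrassCurve.Affine.Point.map (W' := X)
        (IntermediateField.val (IntermediateField.adjoin (v.adicCompletion K) {ζ}))).range := by
  rcases b with _ | ⟨x, y, hxy⟩
  · exact ⟨1, one_ne_zero, fun _ ↦ AddSubgroup.zero_mem _⟩
  · -- the coordinates are fixed by inertia
    have hIx : ∀ τ ∈ 𝔐.inertia (absoluteGaloisGroup (v.adicCompletion K)), τ • x = x ∧ τ • y = y := by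
      intro τ hτ
      have h := hb τ hτ
      rw [WeierstrassCurve.Affine.Point.map_some] at h
      obtain ⟨hx, hy⟩ := WeierstrassCurve.Affine.Point.some.inj h
      exact ⟨hx, hy⟩
    obtain ⟨d₁, hd₁, hFx⟩ := exists_frobenius_pow_smul_eq_self F x
    obtain ⟨d₂, hd₂, hFy⟩ := exists_frobenius_pow_smul_eq_self F y
    have hpow : ∀ (z : AlgebraicClosure (v.adicCompletion K)) (e : ℕ), F ^ e • z = z →
        ∀ k : ℕ, F ^ (e * k) • z = z := by
      intro z e he k
      induction k with
      | zero => rw [mul_zero, pow_zero, one_smul]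
      | succ k ih => rw [Nat.mul_succ, pow_add, mul_smul, he, ih]
    refine ⟨d₁ * d₂, mul_ne_zero hd₁ hd₂, fun {ζ} hζ ↦ ?_⟩
    have hxK := mem_adjoin_of_inertia_of_frobenius_pow_smul_eq hw h𝔐 hF (mul_ne_zero hd₁ hd₂) hζ
      (fun τ hτ ↦ (hIx τ hτ).1) (hpow x d₁ hFx d₂)
    have hyK := mem_adjoin_of_inertia_of_frobenius_pow_smul_eq hw h𝔐 hF (mul_ne_zero hd₁ hd₂) hζ
      (fun τ hτ ↦ (hIx τ hτ).2) (by rw [mul_comm]; exact hpow y d₂ hFy d₁)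
    set Kn := IntermediateField.adjoin (v.adicCompletion K) {ζ} with hKn
    have hns₀ : (X.baseChange Kn).toAffine.Nonsingular (⟨x, hxK⟩ : Kn) ⟨y, hyK⟩ :=
      (WeierstrassCurve.Affine.baseChange_nonsingular (W := X) (IntermediateField.val Kn).injective
        (⟨x, hxK⟩ : Kn) ⟨y, hyK⟩).mp hxy
    refine ⟨.some ⟨x, hxK⟩ ⟨y, hyK⟩ hns₀, ?_⟩
    rw [WeierstrassCurve.Affine.Point.map_some]
    rfl

end IsDedekindDomain.HeightOneSpectrum

end
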